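import Literature.MathematicalPhysics.QuantumFieldTheory.Balaban1983to89.B9Ineq346L2RightDiff
import Literature.MathematicalPhysics.QuantumFieldTheory.Balaban1983to89.B9Eq376DerivDict

/-!
# `Balaban1983to89.B9Ineq377POneRightKernel` — [Balaban1985BackgroundPropagators] (3.76)–(3.77) pp. 405–406 «P₁(A) … |P₁(A)J| ≦ O(1)α₁(Lʲη)⁻²…»
# IN KERNEL FORM WITH THE KERNEL CARRIED BY THE RIGHT LETTER: the four words of `P₁(A) = (D′−D)R(U)D* + DR(U)(D*′−D*) + (D′−D)R(U)(D*′−D*) +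
# D′P′(A)D*′` ((3.76) with (3.75) inserted; `R(U) = G′Q′*C⁻¹Q′G′`, `P′(A)` of (3.68)) have KERNEL bounds `O(1)α₁(Lʲη)⁻²e^{−ρd(y,y′)}(L^{j′}η)^{−d}` on
# the bond carrier — because in every word the rightmost difference `D*` is preceded by `G′(U)` (inside `R`) or by `G′(U′U)`/`G′(U)` (inside `P′`),
# so the word is «block majorants of everything on the left × the KERNEL of the right entry `G′D*` (Theorem 3.1 (3.42)₃ in [4]'s kernel form) /
# of the (3.68) kernel members of `P′(A)`», the first-order difference letters `D*′ − D*` entering through their COLUMNS; FILE 43 of the Sect. B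
# programme of cell `lit-balaban`, seat r06 gen 19 — second input of Theorem 3.3's `L²` member (3.46)₆ for `G(U′U)` (the `P₁`-part of the kernel of
# `G(U′U)·V(A)` with `V(A)` on the right, (3.84)–(3.86) p. 407)

statement-level skeleton of published theorems with citation tags; proofs where landed; nothing here is a claim about the Yang–Mills mass gap

CITATION HEADER (lean-in-tree rule).  B9 = T. Bałaban, *Propagators for lattice gauge theories in a background field*, Commun. Math. Phys. **99** (1985)
389–434 [Balaban1985BackgroundPropagators] (doi 10.1007/bf01240355; `paper:balaban1985-cmp99-background-propagators`, journal page = PDF page + 388):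
(3.76)–(3.77) pp. 405–406 [PDF 17–18] («P₁(A) = …», «|P₁(A)J| ≦ O(1)α₁…» — display (3.77) with the weight `(Lʲη)⁻²`), (3.68) p. 403 («|P′(A;x,x′)|,
|(DP′(A))_μ(x,x′)|, |(P′(A)D*)_ν(x,x′)|, |(DP′(A)D*)_{μν}(x,x′)| ≦ O(1)α₁[1, (Lʲη)⁻¹, (Lʲη)⁻¹, (Lʲη)⁻²](L^{j′}η)^{−d}e^{−(1/2)δ₀d(y,y′)}»), (3.70) p. 404 and
(3.74) p. 405 (the sizes of `D_{U′U} − D_U`, `D*_{U′U} − D*_U`: «O(1)α₁(Lʲη)⁻¹»), (3.25) p. 394 (`R = G′Q′*C⁻¹Q′G′`), Theorem 3.1 (3.42) p. 397 (the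
entries `G′`, `∇G′`, `G′∇*` of `G′(U)`), (3.3) p. 391 and (3.8) p. 392 (`D`, `D* = Σ_μ D*_μ`), p. 398 [PDF 10] L20–24 remark («Using Lemma 2.1 in [4] we
may replace the factor (Lʲη)^α by (Lʲη)^β(L^{j′}η)^γ with β + γ = α»), (3.84)–(3.86) p. 407 (the use: the remainder `G(U′U)V(A)G(U)`).  [4] = B6 =
[Balaban1984PropagatorsII]: (2.51)–(2.55) p. 232 (block majorants, products, «insert Σ_{y″}Δ(y″) = I»), Lemma 2.1 (2.60)–(2.61) p. 234, (2.64)–(2.66)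
p. 234 (the kernel shape).  The factorisation «majorants on the left × kernel of the right entry» and the column reading are this lineage's bookkeeping.

WHAT THIS FILE PROVES (theorems only; no `def`, no `sorry`, no new named fact).
* §1 THE BOND ← SITE KERNEL DICTIONARY: a bond letter `X∘M∘Y` dressed by a GRADIENT-type left letter (`(Xm)((μ,x),i) = (X_μ m)(x,i)`: `D_U`, `D_{U′U}`,
  their difference — `B9Eq376DerivDict.conjHom_gradLin_apply`) and a DIVERGENCE-type right letter (`YF = −Σ_ν Y_ν F_ν`: `D*_U`, `D*_{U′U}`, their
  difference — `conjHom_divLin_eq_sum`) acts as `(X∘M∘Y)F = −Σ_ν (X_μ·M·Y_ν)(F_ν)` (`dressed_apply`), so ITS KERNEL ENTRIES ARE THE KERNEL ENTRIES OF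
  THE SITE WORDS `X_μ·M·Y_ν` (`hasKernelBound_dressed`; `dirRestr_single`).
* §2 THE DIFFERENCE LETTERS ON THE SITE CARRIER: `∇^{U′U}_{μ} − ∇^{U}_{μ}` has the block majorant `4Mα₁(Lʲη)⁻¹e^{δd₀}e^{−δd}` (`hasMajorant_diffLetter_sub_inl`,
  (3.70)) and `∇*^{U′U}_{ν} − ∇*^{U}_{ν}` the COLUMN bound `(#ιM)·4α₁(Lʲ″η)⁻¹e^{δd₀}e^{−δd}` (`col_diffLetter_sub_inr`, (3.74); FILE 41's `col_conj_of_local`).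
* §3 GENERIC DEVICES (any carrier): kernel bounds of the site words `Δ·G′·Mid·(G′D*)` (`hasKernelBound_word_one`), `L·Mid·(G′·Δ*)` with a left
  majorant letter `L` (`hasKernelBound_word_two`; `L = DG′` or `ΔG′`) and `(D+Δ)·P′·(D*+Δ*)` (`hasKernelBound_word_pPrime`) from block majorants of the
  left letters, the kernels of `G′`, `G′D*` and of the four (3.68) members of `P′`, and the column of `Δ*` — compositions `hasMajorant_comp_decay`,
  `hasKernelBound_comp_decay`, FILE 41's `hasKernelBound_mul_col`.
* §4 **`hasKernelBound_pOne_right`**: the KERNEL bound `|(P₁(A))(q,q′)| ≦ K₁·α₁·(Lʲη)⁻²·e^{−ρd(y,y′)}·v(y′)⁻¹` on the bond carrier for the concrete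
  four-word `P₁(A)` of FILE 28's `Δ_a(U′U)` (typed letters `conjHom b (gradLin …)`, `conjHom b (divLin …)` at `U` and `U′U`, any site letters
  `R = G′·Mid·G′` and `P′`), from Theorem 3.1's (3.42)₁,₂ majorants and (3.42)₁,₃ KERNELS for `G′(U)`, a block majorant of `Mid` (print:
  `Q′*C⁻¹Q′`, `O(1)(Lʲη)⁻⁴`), the four (3.68) kernel members of `P′` (FILE 33's shapes) and (3.37) blockwise — explicit `K₁`.

HONEST SCOPE / NOT CLAIMED.  (i) This is the `P₁`-part of the kernel of `W = G(U′U)·V(A)` (V on the right); the `V₃`-part is FILE 42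
(`B9Ineq385V3RightKernel`), the `P₂`-part (abstract averaging letters: column hypotheses) and the `L²` member (3.46)₆ for `G(U′U)` are FILE 44.
(ii) `Mid`, `P′` and their bounds are INPUTS here (FILE 44 feeds `Mid = Q′*C⁻¹Q′` from (3.19)/(3.48) and `P′(A)` from FILE 33 `thm34_pPrime_kernel_final`);
Theorem 3.1's entries for `G′(U)` in BOTH block-majorant and kernel form are hypotheses (as in FILES 16/29/33).  (iii) Group-valued background,
`η = g.eta > 0`, `ηα₁(Lʲη)⁻¹ ≦ 1/4`, (3.37) blockwise for `A` and `τ*A`; constants explicit, lattice-independent, not optimised; rates: inputs at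
`δ_G ≧ ρ₃`, `δ_M, δ_P ≧ ρ₁`, output `ρ` with `ρ + (α+β)δ₀ ≦ ρ₁ ≦ ρ₂ − (α+β)δ₀ ≦ ρ₃ − 2(α+β)δ₀`, columns at `ρ + γ`.  (iv) Block-calculus typing of the
lineage; NOT summit progress.

RELATED IN THE TREE, NOT DUPLICATED (searched 2026-08-23: `lean search --decl 'POneRightKernel|hasKernelBound_dressed|dirRestr_single'` = ∅): FILE 25
`B9Thm34GKernelFinal.hasMajorant_pOne_site`/`exists_threshold_pOne` give (3.77) as a block MAJORANT (two-space device `B9Ineq377POneConcrete.ineq377_hom`);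
`B9Eq376DerivDict` is the MAJORANT dictionary (`hasMajorant_gradLin_comp_comp_divLin`, one configuration); here: the KERNEL dictionary for mixed
configurations and the kernel form of (3.77) with the kernel on the right letter.
-/

noncomputable section

namespace Literature.MathematicalPhysics.QuantumFieldTheory.Balaban1983to89.B9Ineq377POneRightKernel

open NormedSpace Complex
open Literature.MathematicalPhysics.QuantumFieldTheory.Balaban1983to89
open Literature.MathematicalPhysics.QuantumFieldTheory.Balaban1983to89.B6RandomWalk (HasMajorant BlockSupp hasMajorant_mono hasMajorant_add Triangle254 Ineq261)
open Literature.MathematicalPhysics.QuantumFieldTheory.Balaban1983to89.B6RandomWalkKernel (ker HasKernelBound hasKernelBound_mono hasKernelBound_add)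
open Literature.MathematicalPhysics.QuantumFieldTheory.Balaban1983to89.B9Thm34Ext (toB6)
open Literature.MathematicalPhysics.QuantumFieldTheory.Balaban1983to89.B9Ineq347 (ScaleTransfer)
open Literature.MathematicalPhysics.QuantumFieldTheory.Balaban1983to89.B9Ineq385Kernel (hasKernelBound_comp_decay hasKernelBound_rate_mono exp_rate_mono)
open Literature.MathematicalPhysics.QuantumFieldTheory.Balaban1983to89.B9Ineq366CPrime (hasMajorant_comp_decay hasMajorant_rate_mono)
open Literature.MathematicalPhysics.QuantumFieldTheory.Balaban1983to89.B9Eq39Adjoint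
open Literature.MathematicalPhysics.QuantumFieldTheory.Balaban1983to89.B9Eq352DivForm (tauF tauB tauF_apply tauB_apply)
open Literature.MathematicalPhysics.QuantumFieldTheory.Balaban1983to89.B9Eq352DivFormLetters
open Literature.MathematicalPhysics.QuantumFieldTheory.Balaban1983to89.B9Eq352GradLetters (diffLetter diffLetter_inl diffLetter_inr)
open Literature.MathematicalPhysics.QuantumFieldTheory.Balaban1983to89.B9Eq370Expansion (norm_covDstar_prodCfg_sub_le)
open Literature.MathematicalPhysics.QuantumFieldTheory.Balaban1983to89.B9Eq376POneLetters (conjHom conjHom_apply gradLin divLin gradLin_apply divLin_apply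
  norm_gradLin_sub_apply_le)
open Literature.MathematicalPhysics.QuantumFieldTheory.Balaban1983to89.B9Eq376DerivDict (dirRestr dirRestr_apply conjHom_gradLin_apply conjHom_divLin_eq_sum)
open Literature.MathematicalPhysics.QuantumFieldTheory.Balaban1983to89.B9Ineq346L2RightDiff (col_conj_of_local hasKernelBound_mul_col)

/-! ## §1  The bond ← site kernel dictionary for dressed words `X∘M∘Y` -/

section Dict

variable {ι : Type} [DecidableEq ι] {S : Type} [DecidableEq S] {κ : Type} [Fintype κ] [DecidableEq κ]
variable {g : B9.Geometry} [Fintype g.Site] {Rr : ℝ} {H : Prop}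

omit [DecidableEq ι] [DecidableEq S] [DecidableEq κ] [Fintype g.Site] in
/-- **A dressed word acts through the site words**: if `X` is of gradient type (`(Xm)((μ,x),i) = (X_μ m)(x,i)`) and `Y` of divergence type
(`YF = −Σ_ν Y_ν(F_ν)`), then `(X∘M∘Y)F((μ,x),i) = −Σ_ν (X_μ·M·Y_ν)(F_ν)(x,i)` — (3.3)/(3.8) bookkeeping.
[cite: Balaban1985BackgroundPropagators, (3.3) p.391 + (3.8) p.392 + (3.76) p.405 (bookkeeping ours)] -/
theorem dressed_apply {X : (S × ι → ℝ) →ₗ[ℝ] ((κ × S) × ι → ℝ)} {Xs : κ → Module.End ℝ (S × ι → ℝ)}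
    {Y : ((κ × S) × ι → ℝ) →ₗ[ℝ] (S × ι → ℝ)} {Ys : κ → Module.End ℝ (S × ι → ℝ)}
    (hX : ∀ (m : S × ι → ℝ) (q : (κ × S) × ι), X m q = Xs q.1.1 m (q.1.2, q.2))
    (hY : ∀ F : (κ × S) × ι → ℝ, Y F = -∑ ν, Ys ν (dirRestr ν F))
    (M : Module.End ℝ (S × ι → ℝ)) (F : (κ × S) × ι → ℝ) (q : (κ × S) × ι) :
    (X ∘ₗ M ∘ₗ Y) F q = -∑ ν, (Xs q.1.1 * M * Ys ν) (dirRestr ν F) (q.1.2, q.2) := by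
  simp only [LinearMap.comp_apply, hY, map_neg, map_sum, Pi.neg_apply, Finset.sum_apply, hX, Module.End.mul_apply]

omit [Fintype κ] [Fintype g.Site] in
/-- The direction-`ν` restriction of a point mass of the bond carrier is a point mass of the site carrier (same direction) or zero.
[cite: Balaban1985BackgroundPropagators, (3.39) p.397 (bookkeeping ours)] -/
theorem dirRestr_single (ν ν' : κ) (x' : S) (i' : ι) :
    dirRestr ν (Pi.single ((ν', x'), i') (1 : ℝ) : (κ × S) × ι → ℝ) = if ν' = ν then Pi.single (x', i') 1 else 0 := by
  funext p
  rw [dirRestr_apply]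
  by_cases h : ν' = ν
  · subst h
    rw [if_pos rfl]
    by_cases hp : p = (x', i')
    · subst hp; simp
    · have hne : ((ν', p.1), p.2) ≠ ((ν', x'), i') := fun e => hp (by
        simp only [Prod.mk.injEq] at e
        exact Prod.ext e.1.2 e.2)
      rw [Pi.single_eq_of_ne hp, Pi.single_eq_of_ne hne]
  · have hne : ((ν, p.1), p.2) ≠ ((ν', x'), i') := fun e => h (by
      simp only [Prod.mk.injEq] at e
      exact e.1.1.symm)
    rw [if_neg h, Pi.zero_apply, Pi.single_eq_of_ne hne]

/-- **THE KERNEL DICTIONARY**: kernel bounds of all the site words `X_μ·M·Y_ν` give the SAME kernel bound for the dressed bond word `X∘M∘Y` (bond block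
map = block of the base point; the `(q,q′)` entry of `X∘M∘Y`, `q = ((μ,x),i)`, `q′ = ((ν′,x′),i′)`, is minus the `((x,i),(x′,i′))` entry of `X_μ·M·Y_{ν′}`).
[cite: Balaban1985BackgroundPropagators, (3.3) p.391 + (3.8) p.392 + (3.76)–(3.77) pp.405–406; Balaban1984PropagatorsII, (2.64)–(2.66) p.234 (bookkeeping ours)] -/
theorem hasKernelBound_dressed (blk : S → g.Site) {v : g.Site → ℝ} {cK : ℝ}
    {X : (S × ι → ℝ) →ₗ[ℝ] ((κ × S) × ι → ℝ)} {Xs : κ → Module.End ℝ (S × ι → ℝ)}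
    {Y : ((κ × S) × ι → ℝ) →ₗ[ℝ] (S × ι → ℝ)} {Ys : κ → Module.End ℝ (S × ι → ℝ)}
    (hX : ∀ (m : S × ι → ℝ) (q : (κ × S) × ι), X m q = Xs q.1.1 m (q.1.2, q.2))
    (hY : ∀ F : (κ × S) × ι → ℝ, Y F = -∑ ν, Ys ν (dirRestr ν F))
    (M : Module.End ℝ (S × ι → ℝ)) {K : g.Site → g.Site → ℝ}
    (h : ∀ μ ν : κ, HasKernelBound (g := toB6 g Rr H) (fun p : S × ι => blk p.1) v cK (Xs μ * M * Ys ν) K) :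
    HasKernelBound (g := toB6 g Rr H) (fun q : (κ × S) × ι => blk q.1.2) v cK (X ∘ₗ M ∘ₗ Y) K := by
  classical
  rintro q ⟨⟨ν', x'⟩, i'⟩
  have hmain := h q.1.1 ν' (q.1.2, q.2) (x', i')
  rw [ker] at hmain ⊢
  rw [dressed_apply hX hY M, Finset.sum_eq_single ν', dirRestr_single, if_pos rfl, mul_neg, abs_neg]
  · exact hmain
  · intro ν _ hne
    rw [dirRestr_single, if_neg (Ne.symm hne), map_zero, Pi.zero_apply]
  · intro hν; exact absurd (Finset.mem_univ _) hν

variable {𝔸 : Type*} [NormedRing 𝔸] [NormedAlgebra ℂ 𝔸] [Fintype ι] (b : Module.Basis ι ℝ 𝔸)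
variable (T : κ → Equiv.Perm S)

omit [DecidableEq ι] [DecidableEq S] [Fintype κ] [DecidableEq κ] [Fintype g.Site] in
/-- `D_V` (sites → bonds) is of gradient type with site letters `∇^V_{inl μ}` (`B9Eq376DerivDict.conjHom_gradLin_apply`), and so is the difference
`D_{V′} − D_V` with site letters `∇^{V′}_{inl μ} − ∇^{V}_{inl μ}`. [cite: Balaban1985BackgroundPropagators, (3.3) p.391 + (3.70) p.404] -/
theorem gradType_sub (c : ℂ) (V V' : κ → S → 𝔸ˣ) (m : S × ι → ℝ) (q : (κ × S) × ι) :
    (conjHom b (gradLin T c V') - conjHom b (gradLin T c V)) m q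
      = (conj b (diffLetter T V' c (Sum.inl q.1.1)) - conj b (diffLetter T V c (Sum.inl q.1.1))) m (q.1.2, q.2) := by
  rw [LinearMap.sub_apply, Pi.sub_apply, LinearMap.sub_apply, Pi.sub_apply, conjHom_gradLin_apply, conjHom_gradLin_apply]

omit [DecidableEq ι] [DecidableEq S] [DecidableEq κ] [Fintype g.Site] in
/-- `D*_{V′} − D*_V` (bonds → sites) is of divergence type with site letters `∇^{V′}_{inr ν} − ∇^{V}_{inr ν}` (`conjHom_divLin_eq_sum`).
[cite: Balaban1985BackgroundPropagators, (3.8) p.392 + (3.74) p.405] -/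
theorem divType_sub (c : ℂ) (V V' : κ → S → 𝔸ˣ) (F : (κ × S) × ι → ℝ) :
    (conjHom b (divLin T c V') - conjHom b (divLin T c V)) F
      = -∑ ν, (conj b (diffLetter T V' c (Sum.inr ν)) - conj b (diffLetter T V c (Sum.inr ν))) (dirRestr ν F) := by
  rw [LinearMap.sub_apply, conjHom_divLin_eq_sum, conjHom_divLin_eq_sum]
  simp only [LinearMap.sub_apply, Finset.sum_sub_distrib]
  abel

end Dict

/-! ## §2  The difference letters `∇^{U′U} − ∇^{U}` on the site carrier: block majorant (left use) and column (right use) -/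

section DiffLetters

variable {𝔸 : Type*} [NormedRing 𝔸] [NormedAlgebra ℂ 𝔸] [CompleteSpace 𝔸] {ι : Type} [Fintype ι] [DecidableEq ι] (b : Module.Basis ι ℝ 𝔸)
variable {S : Type} [Fintype S] [DecidableEq S] {κ : Type} [Fintype κ]
variable (T : κ → Equiv.Perm S) (U : κ → S → 𝔸ˣ)
variable {g : B9.Geometry} [Fintype g.Site] [DecidableEq g.Site] {Rr : ℝ} {H : Prop}

omit [DecidableEq ι] [Fintype S] [DecidableEq S] [Fintype κ] [DecidableEq g.Site] in
/-- **`Δ_μ = ∇^{U′U}_{μ} − ∇^{U}_{μ} ≺ 4Mα₁(Lʲη)⁻¹e^{δd₀}·e^{−δd}`** on the site carrier (`M = M₂Σ‖b_i‖`): the one-space reading of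
`B9Eq376POneLetters.hasMajorantHom_gradLin_sub` — (3.70)'s pointwise size `norm_gradLin_sub_apply_le` («η⁻¹(e^{2η|A|} − 1) ≦ 4|A|» for
`η|A| ≦ 1/2`), (3.37) blockwise, stencil `{x + e_μ}`, seam `hasMajorant_conj_of_local`.
[cite: Balaban1985BackgroundPropagators, (3.70) p.404 + (3.76) p.405 + (3.37) p.396; Balaban1984PropagatorsII, (2.51) p.232] -/
theorem hasMajorant_diffLetter_sub_inl (blk : S → g.Site) {η : ℝ} (hη : 0 < η)
    (hU1 : ∀ μ x, ‖((U μ x : 𝔸ˣ) : 𝔸)‖ ≤ 1 ∧ ‖(((U μ x)⁻¹ : 𝔸ˣ) : 𝔸)‖ ≤ 1) (A : κ → S → 𝔸) (d₀ δ M₂ α₁ : ℝ)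
    (hα₁ : 0 ≤ α₁) (hδ : 0 ≤ δ) (hM₂ : 0 ≤ M₂) (hrepr : ∀ (w : 𝔸) (i : ι), |b.repr w i| ≤ M₂ * ‖w‖)
    (hlen : ∀ y : g.Site, 0 < g.len y) (hA : ∀ k x, ‖A k x‖ ≤ α₁ * (g.len (blk x))⁻¹)
    (hsmall : ∀ y : g.Site, η * (α₁ * (g.len y)⁻¹) ≤ 1 / 4) (hd₀F : ∀ μ x, g.dist (blk x) (blk (T μ x)) ≤ d₀) (μ : κ) :
    HasMajorant (g := toB6 g Rr H) (fun p : S × ι => blk p.1)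
      (conj b (diffLetter T (prodCfg U η A) ((η : ℂ)⁻¹) (Sum.inl μ)) - conj b (diffLetter T U ((η : ℂ)⁻¹) (Sum.inl μ)))
      (fun a a' => 4 * (M₂ * ∑ i, ‖b i‖) * Real.exp (δ * d₀) * α₁ * (g.len a)⁻¹ * Real.exp (-(δ * g.dist a a'))) := by
  have hc : ∀ a : g.Site, 0 ≤ 4 * (α₁ * (g.len a)⁻¹) := fun a =>
    mul_nonneg (by norm_num) (mul_nonneg hα₁ (inv_nonneg.mpr (hlen a).le))
  rw [← conj_sub]
  have h := hasMajorant_conj_of_local (Rr := Rr) (H := H) b blk (fun x x' => x' = T μ x) (fun a => 4 * (α₁ * (g.len a)⁻¹)) d₀ δ M₂ hc hδ hM₂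
    hrepr (fun x x' hx' => by rw [hx']; exact hd₀F μ x)
    (diffLetter T (prodCfg U η A) ((η : ℂ)⁻¹) (Sum.inl μ) - diffLetter T U ((η : ℂ)⁻¹) (Sum.inl μ)) ?_
  · exact hasMajorant_mono (g := toB6 g Rr H) _ h fun a a' => le_of_eq (by ring)
  intro f x B hB
  have hsm : η * ‖A μ x‖ ≤ 1 / 2 :=
    (mul_le_mul_of_nonneg_left (hA μ x) hη.le).trans ((hsmall _).trans (by norm_num))
  have e : (diffLetter T (prodCfg U η A) ((η : ℂ)⁻¹) (Sum.inl μ) - diffLetter T U ((η : ℂ)⁻¹) (Sum.inl μ)) f x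
      = (gradLin T ((η : ℂ)⁻¹) (prodCfg U η A) - gradLin T ((η : ℂ)⁻¹) U) f (μ, x) := by
    simp only [LinearMap.sub_apply, Pi.sub_apply, diffLetter_inl, gradLetterF_apply, gradLin_apply]
  rw [e]
  refine (norm_gradLin_sub_apply_le T U hη.le hU1 A _ f (μ, x) hsm).trans ?_
  have hcη : ‖((η : ℂ)⁻¹)‖ = η⁻¹ := by rw [norm_inv, Complex.norm_real, Real.norm_eq_abs, abs_of_pos hη]
  rw [hcη]
  have hfB : ‖f (T μ x)‖ ≤ B := hB _ rfl
  calc η⁻¹ * (4 * (η * ‖A μ x‖)) * ‖f (T μ x)‖ = 4 * ‖A μ x‖ * ‖f (T μ x)‖ := by field_simp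
    _ ≤ 4 * (α₁ * (g.len (blk x))⁻¹) * B := mul_le_mul (mul_le_mul_of_nonneg_left (hA μ x) (by norm_num)) hfB (norm_nonneg _) (hc _)

omit [Fintype κ] in
/-- **THE COLUMN OF `Δ*_ν = ∇*^{U′U}_{ν} − ∇*^{U}_{ν}`** (reads `G` at `x − e_ν`; reverse stencil `{x′ + e_ν}`): `Σ_{z∈Δ(y″)}|(Δ*_νδ_{z′})(z)| ≦
(#ι·M₂Σ‖b_i‖)·4α₁(Lʲ″η)⁻¹e^{δd₀}·e^{−δd(y″,y′)}` — (3.74)'s pointwise size (`B9Eq370Expansion.norm_covDstar_prodCfg_sub_le`, «η⁻¹(e^{2η|τ*A|} − 1) ≦ 4|τ*A|»),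
(3.37) for `τ*_νA_ν` blockwise, FILE 41's column seam `col_conj_of_local`.
[cite: Balaban1985BackgroundPropagators, (3.74) p.405 + (3.76) p.405 + (3.37) p.396; Balaban1984PropagatorsII, (2.51) p.232 (column reading ours)] -/
theorem col_diffLetter_sub_inr (blk : S → g.Site) {η : ℝ} (hη : 0 < η)
    (hU1 : ∀ μ x, ‖((U μ x : 𝔸ˣ) : 𝔸)‖ ≤ 1 ∧ ‖(((U μ x)⁻¹ : 𝔸ˣ) : 𝔸)‖ ≤ 1) (A : κ → S → 𝔸) (d₀ δ M₂ α₁ : ℝ)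
    (hα₁ : 0 ≤ α₁) (hδ : 0 ≤ δ) (hM₂ : 0 ≤ M₂) (hrepr : ∀ (w : 𝔸) (i : ι), |b.repr w i| ≤ M₂ * ‖w‖)
    (hlen : ∀ y : g.Site, 0 < g.len y) (hAτB : ∀ ν x, ‖tauB T U ν (A ν) x‖ ≤ α₁ * (g.len (blk x))⁻¹)
    (hsmall : ∀ y : g.Site, η * (α₁ * (g.len y)⁻¹) ≤ 1 / 4) (hd₀B : ∀ ν x, g.dist (blk x) (blk ((T ν).symm x)) ≤ d₀) (ν : κ) :
    ∀ (z' : S × ι) (y'' : g.Site),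
      (∑ z ∈ Finset.univ.filter (fun z : S × ι => blk z.1 = y''),
        |conj b (diffLetter T (prodCfg U η A) ((η : ℂ)⁻¹) (Sum.inr ν) - diffLetter T U ((η : ℂ)⁻¹) (Sum.inr ν)) (Pi.single z' 1) z|) ≤
        (Fintype.card ι * M₂ * ∑ i, ‖b i‖) * ((4 * (α₁ * (g.len y'')⁻¹)) * Real.exp (δ * d₀) * Real.exp (-(δ * g.dist y'' (blk z'.1)))) := by
  have hc : ∀ a : g.Site, 0 ≤ 4 * (α₁ * (g.len a)⁻¹) := fun a =>
    mul_nonneg (by norm_num) (mul_nonneg hα₁ (inv_nonneg.mpr (hlen a).le))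
  have hT : ∀ (G : S → 𝔸) (x : S) (B : ℝ), (∀ x'', x'' = (T ν).symm x → ‖G x''‖ ≤ B) →
      ‖(diffLetter T (prodCfg U η A) ((η : ℂ)⁻¹) (Sum.inr ν) - diffLetter T U ((η : ℂ)⁻¹) (Sum.inr ν)) G x‖ ≤ 4 * (α₁ * (g.len (blk x))⁻¹) * B := by
    intro G x B hB
    have hsm : η * ‖tauB T U ν (A ν) x‖ ≤ 1 / 2 :=
      (mul_le_mul_of_nonneg_left (hAτB ν x) hη.le).trans ((hsmall _).trans (by norm_num))
    have e : (diffLetter T (prodCfg U η A) ((η : ℂ)⁻¹) (Sum.inr ν) - diffLetter T U ((η : ℂ)⁻¹) (Sum.inr ν)) G x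
        = -(((η : ℂ)⁻¹) • (covDstar T (prodCfg U η A) ν G x - covDstar T U ν G x)) := by
      simp only [LinearMap.sub_apply, Pi.sub_apply, diffLetter_inr, LinearMap.neg_apply, Pi.neg_apply, gradLetterB_apply, smul_sub]
      abel
    rw [e, norm_neg, norm_smul]
    have hcη : ‖((η : ℂ)⁻¹)‖ = η⁻¹ := by rw [norm_inv, Complex.norm_real, Real.norm_eq_abs, abs_of_pos hη]
    rw [hcη]
    have eτ : R (U ν ((T ν).symm x))⁻¹ (A ν ((T ν).symm x)) = tauB T U ν (A ν) x := (tauB_apply T U ν (A ν) x).symm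
    have h1 := norm_covDstar_prodCfg_sub_le T U hη.le A ν G x
    rw [eτ] at h1
    have h2 : Real.exp (2 * (η * ‖tauB T U ν (A ν) x‖)) - 1 ≤ 4 * (η * ‖tauB T U ν (A ν) x‖) :=
      B9Eq376POneLetters.exp_two_mul_sub_one_le_four_mul (mul_nonneg hη.le (norm_nonneg _)) hsm
    have h3 : ‖R (U ν ((T ν).symm x))⁻¹ (G ((T ν).symm x))‖ ≤ ‖G ((T ν).symm x)‖ := by
      have := B9Eq369Small.norm_R_inv_le_rho (hU1 ν ((T ν).symm x)).1 (hU1 ν ((T ν).symm x)).2 (G ((T ν).symm x))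
      simpa using this
    have hGB : ‖G ((T ν).symm x)‖ ≤ B := hB _ rfl
    have hB0 : 0 ≤ B := (norm_nonneg _).trans hGB
    have h0 : 0 ≤ Real.exp (2 * (η * ‖tauB T U ν (A ν) x‖)) - 1 := by
      rw [sub_nonneg]; exact Real.one_le_exp (by positivity)
    calc η⁻¹ * ‖covDstar T (prodCfg U η A) ν G x - covDstar T U ν G x‖
        ≤ η⁻¹ * ((4 * (η * ‖tauB T U ν (A ν) x‖)) * B) :=
          mul_le_mul_of_nonneg_left (h1.trans (mul_le_mul h2 (h3.trans hGB) (norm_nonneg _) (by positivity))) (inv_nonneg.mpr hη.le)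
      _ = 4 * ‖tauB T U ν (A ν) x‖ * B := by field_simp
      _ ≤ 4 * (α₁ * (g.len (blk x))⁻¹) * B := mul_le_mul_of_nonneg_right (mul_le_mul_of_nonneg_left (hAτB ν x) (by norm_num)) hB0
  have h := col_conj_of_local b blk (fun x x'' => x'' = (T ν).symm x) (fun x' => {T ν x'}) 1 (fun a => 4 * (α₁ * (g.len a)⁻¹)) d₀ δ M₂ hc hδ
    hM₂ hrepr (fun x x' h => by rw [Finset.mem_singleton, h]; simp) (fun x' => by simp)
    (fun x x' hx => by
      rw [Finset.mem_singleton] at hx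
      rw [hx]
      have := hd₀B ν (T ν x')
      simpa using this)
    (diffLetter T (prodCfg U η A) ((η : ℂ)⁻¹) (Sum.inr ν) - diffLetter T U ((η : ℂ)⁻¹) (Sum.inr ν)) hT
  intro z' y''
  refine (h z' y'').trans (le_of_eq ?_)
  simp only [Nat.cast_one, one_mul]

end DiffLetters

/-! ## §3  Generic devices: the kernels of the site words of `P₁(A)` — majorants on the left, the kernel on the right letter -/

section Device

variable {g : B9.Geometry} [Fintype g.Site] [DecidableEq g.Site] {Rr : ℝ} {H : Prop} {W : Type} [Fintype W] [DecidableEq W]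

omit [DecidableEq g.Site] in
/-- **WORD ONE, `Δ·G′·Mid·(G′D*)`** (from `(D′−D)R(U)D*`, `R = G′·Mid·G′`): block majorants `Δ ≺ c_Eα₁(Lʲη)⁻¹e^{−ρ₂d}`, `G′ ≺ B_G(Lʲη)²e^{−ρ₂d}`,
`Mid ≺ κ_M(Lʲη)⁻⁴e^{−ρ₁d}` and the KERNEL `|(G′D*)(x,x′)| ≦ B_KLʲηe^{−ρ₁d}v⁻¹` give `|(Δ·G′·Mid·G′D*)(x,x′)| ≦ Θ₁·α₁·(Lʲη)⁻²e^{−ρd}v(y′)⁻¹`,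
`Θ₁ = c_EB_Gκ_MB_K·(Λc₁)³` (`ρ + (α+β)δ₀ ≦ ρ₁`, `ρ₁ + (α+β)δ₀ ≦ ρ₂`; scale transfers of `(Lʲη)⁻⁴`, `(Lʲη)⁻²`, `Lʲη`).
[cite: Balaban1985BackgroundPropagators, (3.76)–(3.77) pp.405–406 + (3.25) p.394 + (3.42) p.397 + p.398 remark; Balaban1984PropagatorsII, (2.52)–(2.55) p.232 + Lemma 2.1 p.234 + (2.66) p.234] -/
theorem hasKernelBound_word_one (blk : W → g.Site) (d : ℕ) (δ₀ α β ρ ρ₁ ρ₂ Λ cE BG κM BK α₁ : ℝ)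
    (hcE : 0 ≤ cE) (hBG : 0 ≤ BG) (hκM : 0 ≤ κM) (hBK : 0 ≤ BK) (hα₁ : 0 ≤ α₁) (hΛ : 0 ≤ Λ) (hρ : 0 ≤ ρ) (hρ₁ : 0 ≤ ρ₁)
    (hs : 0 ≤ (α + β) * δ₀) (hr : ρ + (α + β) * δ₀ ≤ ρ₁) (hr₁ : ρ₁ + (α + β) * δ₀ ≤ ρ₂)
    (hdnn : ∀ a a' : g.Site, 0 ≤ g.dist a a') (htri : Triangle254 (toB6 g Rr H)) (hlen : ∀ y : g.Site, 0 < g.len y)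
    (h261 : Ineq261 d (toB6 g Rr H) δ₀ β)
    (hT1 : ScaleTransfer g δ₀ α Λ (fun a => g.len a)) (hT2i : ScaleTransfer g δ₀ α Λ (fun a => (g.len a ^ 2)⁻¹))
    (hT4i : ScaleTransfer g δ₀ α Λ (fun a => (g.len a ^ 4)⁻¹))
    {v : g.Site → ℝ} (hv : ∀ y, 0 < v y) {cK : ℝ} (hcK : 0 < cK)
    {Δ Gp Mid Ds : Module.End ℝ (W → ℝ)}
    (hΔ : HasMajorant (g := toB6 g Rr H) blk Δ (fun a a' => cE * α₁ * (g.len a)⁻¹ * Real.exp (-(ρ₂ * g.dist a a'))))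
    (hGp : HasMajorant (g := toB6 g Rr H) blk Gp (fun a a' => BG * g.len a ^ 2 * Real.exp (-(ρ₂ * g.dist a a'))))
    (hMid : HasMajorant (g := toB6 g Rr H) blk Mid (fun a a' => κM * (g.len a ^ 4)⁻¹ * Real.exp (-(ρ₁ * g.dist a a'))))
    (hGpDs : HasKernelBound (g := toB6 g Rr H) blk v cK (Gp * Ds) (fun a a' => BK * g.len a * Real.exp (-(ρ₁ * g.dist a a')))) :
    HasKernelBound (g := toB6 g Rr H) blk v cK (Δ * (Gp * Mid * Gp) * Ds)
      (fun a a' => (cE * BG * κM * BK * (Λ * B6.c1 d δ₀ β) ^ 3) * α₁ * (g.len a ^ 2)⁻¹ * Real.exp (-(ρ * g.dist a a'))) := by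
  have hc : 0 ≤ B6.c1 d δ₀ β := B6RandomWalk.c1_nonneg d δ₀ β
  have hρρ₁ : ρ ≤ ρ₁ := by linarith
  have hw2 : ∀ a : g.Site, 0 ≤ g.len a ^ 2 := fun a => sq_nonneg _
  have hw4i : ∀ a : g.Site, 0 ≤ (g.len a ^ 4)⁻¹ := fun a => inv_nonneg.mpr (pow_nonneg (hlen a).le 4)
  have hw2i : ∀ a : g.Site, 0 ≤ (g.len a ^ 2)⁻¹ := fun a => inv_nonneg.mpr (sq_nonneg _)
  have hw1i : ∀ a : g.Site, 0 ≤ (g.len a)⁻¹ := fun a => inv_nonneg.mpr (hlen a).le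
  have hw1 : ∀ a : g.Site, 0 ≤ g.len a := fun a => (hlen a).le
  -- `A = G′·Mid ≺ (B_Gκ_MΛc₁)·(Lʲη)⁻²·e^{−ρ₁d}`
  have hA := hasMajorant_comp_decay (R := Rr) (H := H) blk d δ₀ α β ρ₁ ρ₂ Λ BG κM (fun a => g.len a ^ 2) (fun a => (g.len a ^ 4)⁻¹)
    hw2 hw4i hΛ hBG hκM hρ₁ hr₁ hdnn htri hT4i h261 hGp hMid
  have hA' : HasMajorant (g := toB6 g Rr H) blk (Gp * Mid)
      (fun a a' => (BG * κM * Λ * B6.c1 d δ₀ β) * (g.len a ^ 2)⁻¹ * Real.exp (-(ρ₁ * g.dist a a'))) := by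
    refine hasMajorant_mono (g := toB6 g Rr H) blk hA fun a a' => le_of_eq ?_
    have hℓ : g.len a ≠ 0 := (hlen a).ne'
    field_simp
  -- `B = Δ·A ≺ (c_Eα₁·B_Gκ_MΛc₁·Λc₁)·(Lʲη)⁻¹(Lʲη)⁻²·e^{−ρ₁d}`
  have hΔα : 0 ≤ cE * α₁ := mul_nonneg hcE hα₁
  have hB := hasMajorant_comp_decay (R := Rr) (H := H) blk d δ₀ α β ρ₁ ρ₂ Λ (cE * α₁) (BG * κM * Λ * B6.c1 d δ₀ β)
    (fun a => (g.len a)⁻¹) (fun a => (g.len a ^ 2)⁻¹) hw1i hw2i hΛ hΔα (by positivity) hρ₁ hr₁ hdnn htri hT2i h261 hΔ hA'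
  -- the right entry at the rate `ρ`, then `B × (G′D*)`
  have hK := hasKernelBound_rate_mono (R := Rr) (H := H) blk hv cK BK (fun a => g.len a) hBK hw1 hρρ₁ hdnn hGpDs
  have hT := hasKernelBound_comp_decay (R := Rr) (H := H) blk d δ₀ α β ρ ρ₁ Λ (cE * α₁ * (BG * κM * Λ * B6.c1 d δ₀ β) * Λ * B6.c1 d δ₀ β) BK
    (fun a => (g.len a)⁻¹ * (g.len a ^ 2)⁻¹) (fun a => g.len a) (fun a => mul_nonneg (hw1i a) (hw2i a)) hw1 hΛ (by positivity) hBK hρ hr hdnn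
    htri hT1 h261 hv hcK hB hK
  have e : Δ * (Gp * Mid * Gp) * Ds = Δ * (Gp * Mid) * (Gp * Ds) := by noncomm_ring
  rw [e]
  refine hasKernelBound_mono (g := toB6 g Rr H) blk hv hT fun a a' => le_of_eq ?_
  have hℓ : g.len a ≠ 0 := (hlen a).ne'
  field_simp
set_option maxHeartbeats 400000 in
/-- **WORD TWO, `L·Mid·(G′·Δ*)`** (from `DR(U)(D*′−D*)` with `L = DG′` and from `(D′−D)R(U)(D*′−D*)` with `L = (D′−D)G′`): a block majorant
`L ≺ A_LLʲηe^{−ρ₂d}`, `Mid ≺ κ_M(Lʲη)⁻⁴e^{−ρ₁d}`, the KERNEL `|G′(x,x′)| ≦ B_K(Lʲη)²e^{−ρ₁d}v⁻¹` and the COLUMN `Σ_{z∈Δ(y″)}|(Δ*δ_{z′})(z)| ≦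
c_{E*}α₁(Lʲ″η)⁻¹e^{−(ρ+γ)d(y″,y′)}` give `|(L·Mid·G′·Δ*)(x,x′)| ≦ Θ₂·α₁·(Lʲη)⁻²e^{−ρd}v(y′)⁻¹`, `Θ₂ = A_Lκ_MB_Kc_{E*}·Λ_v(Λc₁)³`.
[cite: Balaban1985BackgroundPropagators, (3.76)–(3.77) pp.405–406 + (3.74) p.405 + (3.42) p.397 + p.398 remark; Balaban1984PropagatorsII, (2.51)–(2.55) p.232 + Lemma 2.1 p.234 + (2.66) p.234] -/
theorem hasKernelBound_word_two (blk : W → g.Site) (d : ℕ) (δ₀ α β γ ρ ρ₁ ρ₂ Λ Λv AL κM BK cEs α₁ : ℝ)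
    (hAL : 0 ≤ AL) (hκM : 0 ≤ κM) (hBK : 0 ≤ BK) (hcEs : 0 ≤ cEs) (hα₁ : 0 ≤ α₁) (hΛ : 0 ≤ Λ) (hΛv : 0 ≤ Λv) (hρ : 0 ≤ ρ) (hρ₁ : 0 ≤ ρ₁)
    (hr : ρ + (α + β) * δ₀ ≤ ρ₁) (hr₁ : ρ₁ + (α + β) * δ₀ ≤ ρ₂)
    (hdnn : ∀ a a' : g.Site, 0 ≤ g.dist a a') (htri : Triangle254 (toB6 g Rr H)) (hlen : ∀ y : g.Site, 0 < g.len y)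
    (h261 : Ineq261 d (toB6 g Rr H) δ₀ β)
    (hT1 : ScaleTransfer g δ₀ α Λ (fun a => g.len a)) (hT1i : ScaleTransfer g δ₀ α Λ (fun a => (g.len a)⁻¹))
    (hT4i : ScaleTransfer g δ₀ α Λ (fun a => (g.len a ^ 4)⁻¹))
    {v : g.Site → ℝ} (hv : ∀ y, 0 < v y) {cK : ℝ} (hcK : 0 < cK)
    (hTv : ∀ a a' : g.Site, Real.exp (-(γ * g.dist a a')) * (v a)⁻¹ ≤ Λv * (v a')⁻¹)
    {L Gp Mid Δs : Module.End ℝ (W → ℝ)}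
    (hL : HasMajorant (g := toB6 g Rr H) blk L (fun a a' => AL * g.len a * Real.exp (-(ρ₂ * g.dist a a'))))
    (hMid : HasMajorant (g := toB6 g Rr H) blk Mid (fun a a' => κM * (g.len a ^ 4)⁻¹ * Real.exp (-(ρ₁ * g.dist a a'))))
    (hGpk : HasKernelBound (g := toB6 g Rr H) blk v cK Gp (fun a a' => BK * g.len a ^ 2 * Real.exp (-(ρ₁ * g.dist a a'))))
    (hΔs : ∀ (x' : W) (y'' : g.Site), (∑ z ∈ Finset.univ.filter (fun z : W => blk z = y''), |Δs (Pi.single x' 1) z|) ≤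
      cEs * α₁ * (g.len y'')⁻¹ * Real.exp (-((ρ + γ) * g.dist y'' (blk x')))) :
    HasKernelBound (g := toB6 g Rr H) blk v cK (L * Mid * (Gp * Δs))
      (fun a a' => (AL * κM * BK * cEs * Λv * (Λ * B6.c1 d δ₀ β) ^ 3) * α₁ * (g.len a ^ 2)⁻¹ * Real.exp (-(ρ * g.dist a a'))) := by
  have hc : 0 ≤ B6.c1 d δ₀ β := B6RandomWalk.c1_nonneg d δ₀ β
  have hw4i : ∀ a : g.Site, 0 ≤ (g.len a ^ 4)⁻¹ := fun a => inv_nonneg.mpr (pow_nonneg (hlen a).le 4)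
  have hw1i : ∀ a : g.Site, 0 ≤ (g.len a)⁻¹ := fun a => inv_nonneg.mpr (hlen a).le
  have hw1 : ∀ a : g.Site, 0 ≤ g.len a := fun a => (hlen a).le
  have hw2 : ∀ a : g.Site, 0 ≤ g.len a ^ 2 := fun a => sq_nonneg _
  -- `E = L·Mid ≺ (A_Lκ_MΛc₁)·Lʲη(Lʲη)⁻⁴·e^{−ρ₁d}`
  have hE := hasMajorant_comp_decay (R := Rr) (H := H) blk d δ₀ α β ρ₁ ρ₂ Λ AL κM (fun a => g.len a) (fun a => (g.len a ^ 4)⁻¹)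
    hw1 hw4i hΛ hAL hκM hρ₁ hr₁ hdnn htri hT4i h261 hL hMid
  -- `C = G′·Δ*`: kernel × column, `(B_Kc_{E*}α₁Λ_vΛc₁)·(Lʲη)²(Lʲη)⁻¹ → Lʲη`, rate `ρ`
  have hCEα : 0 ≤ cEs * α₁ := mul_nonneg hcEs hα₁
  have hC := hasKernelBound_mul_col (R := Rr) (H := H) blk hv hcK d (fun a => g.len a ^ 2) (fun a => (g.len a)⁻¹) hw2 hw1i hBK hCEα hΛ hΛv hρ
    hr hdnn htri hT1i h261 hTv hGpk hΔs
  have hC' : HasKernelBound (g := toB6 g Rr H) blk v cK (Gp * Δs)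
      (fun a a' => (Λv * Λ * B6.c1 d δ₀ β * BK * (cEs * α₁)) * g.len a * Real.exp (-(ρ * g.dist a a'))) := by
    refine hasKernelBound_mono (g := toB6 g Rr H) blk hv hC fun a a' => le_of_eq ?_
    have hℓ : g.len a ≠ 0 := (hlen a).ne'
    field_simp
  -- `E × C`
  have hT := hasKernelBound_comp_decay (R := Rr) (H := H) blk d δ₀ α β ρ ρ₁ Λ (AL * κM * Λ * B6.c1 d δ₀ β)
    (Λv * Λ * B6.c1 d δ₀ β * BK * (cEs * α₁)) (fun a => g.len a * (g.len a ^ 4)⁻¹) (fun a => g.len a)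
    (fun a => mul_nonneg (hw1 a) (hw4i a)) hw1 hΛ (by positivity) (by positivity) hρ hr hdnn htri hT1 h261 hv hcK hE hC'
  have e : L * Mid * (Gp * Δs) = (L * Mid) * (Gp * Δs) := by noncomm_ring
  rw [e]
  refine hasKernelBound_mono (g := toB6 g Rr H) blk hv hT fun a a' => le_of_eq ?_
  have hℓ : g.len a ≠ 0 := (hlen a).ne'
  field_simp

/-- **THE `P′`-WORD, `(D + Δ)·P′·(D* + Δ*)`** (from `D′P′(A)D*′`): the four (3.68) KERNEL members of `P′` — `|P′(x,x′)| ≦ K_Pα₁e^{−ρ₁d}v⁻¹`,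
`|(DP′)(x,x′)|, |(P′D*)(x,x′)| ≦ K_Pα₁(Lʲη)⁻¹e^{−ρ₁d}v⁻¹`, `|(DP′D*)(x,x′)| ≦ K_Pα₁(Lʲη)⁻²e^{−ρ₁d}v⁻¹` — the block majorant of `Δ` (rate `ρ₂`) and the
column of `Δ*` (rate `ρ + γ`) give `|((D+Δ)P′(D*+Δ*))(x,x′)| ≦ Θ_P·α₁·(Lʲη)⁻²e^{−ρd}v(y′)⁻¹` with
`Θ_P = K_P(1 + c_Eα₁Λc₁ + c_{E*}α₁Λ_vΛc₁ + c_Ec_{E*}α₁²Λ_v(Λc₁)²)`.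
[cite: Balaban1985BackgroundPropagators, (3.68) p.403 + (3.76)–(3.77) pp.405–406 + (3.70) p.404 + (3.74) p.405 + p.398 remark; Balaban1984PropagatorsII, (2.51)–(2.55) p.232 + Lemma 2.1 p.234 + (2.66) p.234] -/
theorem hasKernelBound_word_pPrime (blk : W → g.Site) (d : ℕ) (δ₀ α β γ ρ ρ₁ ρ₂ Λ Λv cE cEs KP α₁ : ℝ)
    (hcE : 0 ≤ cE) (hcEs : 0 ≤ cEs) (hKP : 0 ≤ KP) (hα₁ : 0 ≤ α₁) (hΛ : 1 ≤ Λ) (hΛv : 0 ≤ Λv) (hρ : 0 ≤ ρ)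
    (hα : 0 ≤ α) (hδ₀ : 0 ≤ δ₀) (hs : 0 ≤ (α + β) * δ₀)
    (hr : ρ + (α + β) * δ₀ ≤ ρ₁) (hr₁ : ρ₁ + (α + β) * δ₀ ≤ ρ₂)
    (hdnn : ∀ a a' : g.Site, 0 ≤ g.dist a a') (htri : Triangle254 (toB6 g Rr H)) (hlen : ∀ y : g.Site, 0 < g.len y)
    (h261 : Ineq261 d (toB6 g Rr H) δ₀ β)
    (hT1i : ScaleTransfer g δ₀ α Λ (fun a => (g.len a)⁻¹))
    {v : g.Site → ℝ} (hv : ∀ y, 0 < v y) {cK : ℝ} (hcK : 0 < cK)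
    (hTv : ∀ a a' : g.Site, Real.exp (-(γ * g.dist a a')) * (v a)⁻¹ ≤ Λv * (v a')⁻¹)
    {D Δ Pp Ds Δs : Module.End ℝ (W → ℝ)}
    (hΔ : HasMajorant (g := toB6 g Rr H) blk Δ (fun a a' => cE * α₁ * (g.len a)⁻¹ * Real.exp (-(ρ₂ * g.dist a a'))))
    (hΔs : ∀ (x' : W) (y'' : g.Site), (∑ z ∈ Finset.univ.filter (fun z : W => blk z = y''), |Δs (Pi.single x' 1) z|) ≤
      cEs * α₁ * (g.len y'')⁻¹ * Real.exp (-((ρ + γ) * g.dist y'' (blk x'))))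
    (hPp : HasKernelBound (g := toB6 g Rr H) blk v cK Pp (fun a a' => KP * α₁ * Real.exp (-(ρ₁ * g.dist a a'))))
    (hDPp : HasKernelBound (g := toB6 g Rr H) blk v cK (D * Pp) (fun a a' => KP * α₁ * (g.len a)⁻¹ * Real.exp (-(ρ₁ * g.dist a a'))))
    (hPpDs : HasKernelBound (g := toB6 g Rr H) blk v cK (Pp * Ds) (fun a a' => KP * α₁ * (g.len a)⁻¹ * Real.exp (-(ρ₁ * g.dist a a'))))
    (hDPpDs : HasKernelBound (g := toB6 g Rr H) blk v cK (D * Pp * Ds)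
      (fun a a' => KP * α₁ * (g.len a ^ 2)⁻¹ * Real.exp (-(ρ₁ * g.dist a a')))) :
    HasKernelBound (g := toB6 g Rr H) blk v cK ((D + Δ) * Pp * (Ds + Δs))
      (fun a a' => (KP * (1 + cE * α₁ * (Λ * B6.c1 d δ₀ β) + cEs * α₁ * (Λv * Λ * B6.c1 d δ₀ β)
          + cE * cEs * α₁ ^ 2 * (Λv * (Λ * B6.c1 d δ₀ β) ^ 2))) * α₁ * (g.len a ^ 2)⁻¹ * Real.exp (-(ρ * g.dist a a'))) := by
  have hc : 0 ≤ B6.c1 d δ₀ β := B6RandomWalk.c1_nonneg d δ₀ β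
  have hΛ0 : 0 ≤ Λ := zero_le_one.trans hΛ
  have hw1i : ∀ a : g.Site, 0 ≤ (g.len a)⁻¹ := fun a => inv_nonneg.mpr (hlen a).le
  have hw2i : ∀ a : g.Site, 0 ≤ (g.len a ^ 2)⁻¹ := fun a => inv_nonneg.mpr (sq_nonneg _)
  have hρρ₁ : ρ ≤ ρ₁ := by linarith
  have hρρ₂ : ρ + (α + β) * δ₀ ≤ ρ₂ := by linarith
  have hKα : 0 ≤ KP * α₁ := mul_nonneg hKP hα₁
  have hΔα : 0 ≤ cE * α₁ := mul_nonneg hcE hα₁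
  have hΔsα : 0 ≤ cEs * α₁ := mul_nonneg hcEs hα₁
  have hSTone : ScaleTransfer g δ₀ α Λ (fun _ : g.Site => (1 : ℝ)) := fun y y' => by
    simp only [mul_one]
    have h0 : 0 ≤ α * δ₀ * g.dist y y' := mul_nonneg (mul_nonneg hα hδ₀) (hdnn y y')
    exact (Real.exp_le_one_iff.mpr (by linarith)).trans hΛ
  -- T4 = `D·P′·D*` at the rate `ρ`
  have hT4 := hasKernelBound_rate_mono (R := Rr) (H := H) blk hv cK (KP * α₁) (fun a => (g.len a ^ 2)⁻¹) hKα hw2i hρρ₁ hdnn hDPpDs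
  -- T5 = `Δ·(P′D*)`
  have hK5 := hasKernelBound_rate_mono (R := Rr) (H := H) blk hv cK (KP * α₁) (fun a => (g.len a)⁻¹) hKα hw1i hρρ₁ hdnn hPpDs
  have hT5 := hasKernelBound_comp_decay (R := Rr) (H := H) blk d δ₀ α β ρ ρ₂ Λ (cE * α₁) (KP * α₁) (fun a => (g.len a)⁻¹) (fun a => (g.len a)⁻¹)
    hw1i hw1i hΛ0 hΔα hKα hρ hρρ₂ hdnn htri hT1i h261 hv hcK hΔ hK5
  -- T6 = `(DP′)·Δ*`
  have hT6 := hasKernelBound_mul_col (R := Rr) (H := H) blk hv hcK d (fun a => (g.len a)⁻¹) (fun a => (g.len a)⁻¹) hw1i hw1i hKα hΔsα hΛ0 hΛv hρ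
    hr hdnn htri hT1i h261 hTv hDPp hΔs
  -- T7 = `Δ·(P′·Δ*)`
  have hPp1 : HasKernelBound (g := toB6 g Rr H) blk v cK Pp (fun a a' => KP * α₁ * (fun _ : g.Site => (1 : ℝ)) a * Real.exp (-(ρ₁ * g.dist a a'))) :=
    hasKernelBound_mono (g := toB6 g Rr H) blk hv hPp fun a a' => le_of_eq (by simp)
  have hF := hasKernelBound_mul_col (R := Rr) (H := H) blk hv hcK d (fun _ => (1 : ℝ)) (fun a => (g.len a)⁻¹) (fun _ => zero_le_one) hw1i hKα hΔsα
    hΛ0 hΛv hρ hr hdnn htri hT1i h261 hTv hPp1 hΔs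
  have hF' : HasKernelBound (g := toB6 g Rr H) blk v cK (Pp * Δs)
      (fun a a' => (Λv * Λ * B6.c1 d δ₀ β * (KP * α₁) * (cEs * α₁)) * (g.len a)⁻¹ * Real.exp (-(ρ * g.dist a a'))) :=
    hasKernelBound_mono (g := toB6 g Rr H) blk hv hF fun a a' => le_of_eq (by simp)
  have hT7 := hasKernelBound_comp_decay (R := Rr) (H := H) blk d δ₀ α β ρ ρ₂ Λ (cE * α₁) (Λv * Λ * B6.c1 d δ₀ β * (KP * α₁) * (cEs * α₁))
    (fun a => (g.len a)⁻¹) (fun a => (g.len a)⁻¹) hw1i hw1i hΛ0 hΔα (by positivity) hρ hρρ₂ hdnn htri hT1i h261 hv hcK hΔ hF'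
  have hall := hasKernelBound_add (g := toB6 g Rr H) blk
    (hasKernelBound_add (g := toB6 g Rr H) blk (hasKernelBound_add (g := toB6 g Rr H) blk hT4 hT5) hT6) hT7
  have e : (D + Δ) * Pp * (Ds + Δs) = D * Pp * Ds + Δ * (Pp * Ds) + D * Pp * Δs + Δ * (Pp * Δs) := by noncomm_ring
  rw [e]
  refine hasKernelBound_mono (g := toB6 g Rr H) blk hv hall fun a a' => le_of_eq ?_
  have hℓ : g.len a ≠ 0 := (hlen a).ne'
  field_simp

end Device

/-! ## §4  (3.77) in KERNEL form for the concrete four-word `P₁(A)` of FILE 28, the kernel on the right letter -/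

section POne

variable {𝔸 : Type*} [NormedRing 𝔸] [NormedAlgebra ℂ 𝔸] [CompleteSpace 𝔸] {ι : Type} [Fintype ι] [DecidableEq ι] (b : Module.Basis ι ℝ 𝔸)
variable {S : Type} [Fintype S] [DecidableEq S] {κ : Type} [Fintype κ] [DecidableEq κ]
variable (T : κ → Equiv.Perm S) (U : κ → S → 𝔸ˣ)
variable {g : B9.Geometry} [Fintype g.Site] [DecidableEq g.Site] {Rr : ℝ} {H : Prop}

set_option maxHeartbeats 1600000 in
/-- **(3.77) IN KERNEL FORM, THE KERNEL ON THE RIGHT LETTER**: for the concrete `P₁(A) = (D′−D)∘R∘D* + D∘R∘(D*′−D*) + (D′−D)∘R∘(D*′−D*) + D′∘P′∘D*′`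
of FILE 28's `Δ_a(U′U)` (typed letters `D = conjHom b (gradLin η⁻¹ U)`, `D′` at `U′U = prodCfg U η A`, `D*`, `D*′`; ANY site letters `R = G′·Mid·G′`
and `P′`), Theorem 3.1's (3.42)₁,₂ as block majorants and (3.42)₁,₃ as KERNEL bounds for `G′(U)` (rate `δ_G`), a block majorant
`Mid ≺ κ_M(Lʲη)⁻⁴e^{−δ_Md}` (print: `Q′*C⁻¹Q′`, (3.19)/(3.48)), the four (3.68) kernel members of `P′` (rate `δ_P`, FILE 33's shapes) and (3.37) blockwise:
`|(P₁(A))(q,q′)| ≦ K₁·α₁·(Lʲη)⁻²·e^{−ρd(y,y′)}·v(y′)⁻¹` on the bond carrier, `K₁` the explicit constant of the statement — §1's dictionary on each of the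
four words, §3's devices on the site words `Δ_μRD*_ν`, `D_μRΔ*_ν`, `Δ_μRΔ*_ν`, `D′_μP′D*′_ν`, §2's letters.
[cite: Balaban1985BackgroundPropagators, (3.76)–(3.77) pp.405–406 + (3.68) p.403 + (3.70) p.404 + (3.74) p.405 + (3.25) p.394 + Thm 3.1 (3.42) p.397 + (3.37) p.396 + p.398 remark; Balaban1984PropagatorsII, (2.51)–(2.55) p.232 + Lemma 2.1 p.234 + (2.64)–(2.66) p.234] -/
theorem hasKernelBound_pOne_right (blk : S → g.Site) (d : ℕ) (hη : 0 < g.eta) (A : κ → S → 𝔸) (d₀ M₂ : ℝ)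
    (δ₀ α β γ ρ ρ₁ ρ₂ ρ₃ δG δM δP Λ Λv BG κM KP α₁ : ℝ)
    (hBG : 0 ≤ BG) (hκM : 0 ≤ κM) (hKP : 0 ≤ KP) (hα₁ : 0 ≤ α₁) (hM₂ : 0 ≤ M₂) (hΛ : 1 ≤ Λ) (hΛv : 0 ≤ Λv)
    (hρ : 0 ≤ ρ) (hα : 0 ≤ α) (hβ : 0 ≤ β) (hγ : 0 ≤ γ) (hδ₀ : 0 ≤ δ₀)
    (hr : ρ + (α + β) * δ₀ ≤ ρ₁) (hr₁ : ρ₁ + (α + β) * δ₀ ≤ ρ₂) (hr₂ : ρ₂ + (α + β) * δ₀ ≤ ρ₃)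
    (hδG : ρ₃ ≤ δG) (hδM : ρ₁ ≤ δM) (hδP : ρ₁ ≤ δP)
    (hdnn : ∀ a a' : g.Site, 0 ≤ g.dist a a') (htri : Triangle254 (toB6 g Rr H)) (hlen : ∀ y : g.Site, 0 < g.len y)
    (h261 : Ineq261 d (toB6 g Rr H) δ₀ β)
    (hT1 : ScaleTransfer g δ₀ α Λ (fun a => g.len a)) (hT2 : ScaleTransfer g δ₀ α Λ (fun a => g.len a ^ 2))
    (hT1i : ScaleTransfer g δ₀ α Λ (fun a => (g.len a)⁻¹)) (hT2i : ScaleTransfer g δ₀ α Λ (fun a => (g.len a ^ 2)⁻¹))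
    (hT4i : ScaleTransfer g δ₀ α Λ (fun a => (g.len a ^ 4)⁻¹))
    {v : g.Site → ℝ} (hv : ∀ y, 0 < v y) {cK : ℝ} (hcK : 0 < cK)
    (hTv : ∀ a a' : g.Site, Real.exp (-(γ * g.dist a a')) * (v a)⁻¹ ≤ Λv * (v a')⁻¹)
    -- real coordinates, group-valued background, (3.37) blockwise, `ηα₁(Lʲη)⁻¹ ≦ 1/4`, stencil geometry
    (hrepr : ∀ (w : 𝔸) (i : ι), |b.repr w i| ≤ M₂ * ‖w‖)
    (hU1 : ∀ μ x, ‖((U μ x : 𝔸ˣ) : 𝔸)‖ ≤ 1 ∧ ‖(((U μ x)⁻¹ : 𝔸ˣ) : 𝔸)‖ ≤ 1)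
    (hA : ∀ k x, ‖A k x‖ ≤ α₁ * (g.len (blk x))⁻¹) (hAτB : ∀ ν x, ‖tauB T U ν (A ν) x‖ ≤ α₁ * (g.len (blk x))⁻¹)
    (hsmall : ∀ y : g.Site, g.eta * (α₁ * (g.len y)⁻¹) ≤ 1 / 4)
    (hd₀F : ∀ μ x, g.dist (blk x) (blk (T μ x)) ≤ d₀) (hd₀B : ∀ ν x, g.dist (blk x) (blk ((T ν).symm x)) ≤ d₀)
    -- THEOREM 3.1 for `G′(U)`: (3.42)₁,₂ as block majorants, (3.42)₁,₃ as kernel bounds, rate `δ_G`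
    {Gp Mid R Pp : Module.End ℝ (S × ι → ℝ)} (hR : R = Gp * Mid * Gp)
    (h342_1 : HasMajorant (g := toB6 g Rr H) (fun p : S × ι => blk p.1) Gp (fun a a' => BG * g.len a ^ 2 * Real.exp (-(δG * g.dist a a'))))
    (h342_2 : ∀ μ : κ, HasMajorant (g := toB6 g Rr H) (fun p : S × ι => blk p.1)
      (conj b (diffLetter T U ((g.eta : ℂ)⁻¹) (Sum.inl μ)) * Gp) (fun a a' => BG * g.len a * Real.exp (-(δG * g.dist a a'))))
    (hGpk : HasKernelBound (g := toB6 g Rr H) (fun p : S × ι => blk p.1) v cK Gp (fun a a' => BG * g.len a ^ 2 * Real.exp (-(δG * g.dist a a'))))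
    (hGpDk : ∀ ν : κ, HasKernelBound (g := toB6 g Rr H) (fun p : S × ι => blk p.1) v cK
      (Gp * conj b (diffLetter T U ((g.eta : ℂ)⁻¹) (Sum.inr ν))) (fun a a' => BG * g.len a * Real.exp (-(δG * g.dist a a'))))
    -- the middle factor `Mid` of `R = G′·Mid·G′` (print: `Q′*C⁻¹Q′`)
    (hMid : HasMajorant (g := toB6 g Rr H) (fun p : S × ι => blk p.1) Mid (fun a a' => κM * (g.len a ^ 4)⁻¹ * Real.exp (-(δM * g.dist a a'))))
    -- the four (3.68) kernel members of `P′(A)`, rate `δ_P`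
    (hPp : HasKernelBound (g := toB6 g Rr H) (fun p : S × ι => blk p.1) v cK Pp (fun a a' => KP * α₁ * Real.exp (-(δP * g.dist a a'))))
    (hDPp : ∀ μ : κ, HasKernelBound (g := toB6 g Rr H) (fun p : S × ι => blk p.1) v cK (conj b (diffLetter T U ((g.eta : ℂ)⁻¹) (Sum.inl μ)) * Pp)
      (fun a a' => KP * α₁ * (g.len a)⁻¹ * Real.exp (-(δP * g.dist a a'))))
    (hPpDs : ∀ ν : κ, HasKernelBound (g := toB6 g Rr H) (fun p : S × ι => blk p.1) v cK (Pp * conj b (diffLetter T U ((g.eta : ℂ)⁻¹) (Sum.inr ν)))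
      (fun a a' => KP * α₁ * (g.len a)⁻¹ * Real.exp (-(δP * g.dist a a'))))
    (hDPpDs : ∀ μ ν : κ, HasKernelBound (g := toB6 g Rr H) (fun p : S × ι => blk p.1) v cK
      (conj b (diffLetter T U ((g.eta : ℂ)⁻¹) (Sum.inl μ)) * Pp * conj b (diffLetter T U ((g.eta : ℂ)⁻¹) (Sum.inr ν)))
      (fun a a' => KP * α₁ * (g.len a ^ 2)⁻¹ * Real.exp (-(δP * g.dist a a')))) :
    HasKernelBound (g := toB6 g Rr H) (fun q : (κ × S) × ι => blk q.1.2) v cK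
      ((conjHom b (gradLin T ((g.eta : ℂ)⁻¹) (prodCfg U g.eta A)) - conjHom b (gradLin T ((g.eta : ℂ)⁻¹) U)) ∘ₗ R
            ∘ₗ conjHom b (divLin T ((g.eta : ℂ)⁻¹) U)
        + conjHom b (gradLin T ((g.eta : ℂ)⁻¹) U) ∘ₗ R
            ∘ₗ (conjHom b (divLin T ((g.eta : ℂ)⁻¹) (prodCfg U g.eta A)) - conjHom b (divLin T ((g.eta : ℂ)⁻¹) U))
        + (conjHom b (gradLin T ((g.eta : ℂ)⁻¹) (prodCfg U g.eta A)) - conjHom b (gradLin T ((g.eta : ℂ)⁻¹) U)) ∘ₗ R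
            ∘ₗ (conjHom b (divLin T ((g.eta : ℂ)⁻¹) (prodCfg U g.eta A)) - conjHom b (divLin T ((g.eta : ℂ)⁻¹) U))
        + conjHom b (gradLin T ((g.eta : ℂ)⁻¹) (prodCfg U g.eta A)) ∘ₗ Pp ∘ₗ conjHom b (divLin T ((g.eta : ℂ)⁻¹) (prodCfg U g.eta A)))
      (fun a a' => ((4 * (M₂ * ∑ i, ‖b i‖) * Real.exp (ρ₃ * d₀)) * BG * κM * BG * (Λ * B6.c1 d δ₀ β) ^ 3
            + BG * κM * BG * ((Fintype.card ι * M₂ * ∑ i, ‖b i‖) * (4 * Real.exp ((ρ + γ) * d₀))) * Λv * (Λ * B6.c1 d δ₀ β) ^ 3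
            + ((4 * (M₂ * ∑ i, ‖b i‖) * Real.exp (ρ₃ * d₀)) * α₁ * BG * (Λ * B6.c1 d δ₀ β)) * κM * BG
                * ((Fintype.card ι * M₂ * ∑ i, ‖b i‖) * (4 * Real.exp ((ρ + γ) * d₀))) * Λv * (Λ * B6.c1 d δ₀ β) ^ 3
            + KP * (1 + (4 * (M₂ * ∑ i, ‖b i‖) * Real.exp (ρ₂ * d₀)) * α₁ * (Λ * B6.c1 d δ₀ β)
                + ((Fintype.card ι * M₂ * ∑ i, ‖b i‖) * (4 * Real.exp ((ρ + γ) * d₀))) * α₁ * (Λv * Λ * B6.c1 d δ₀ β)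
                + (4 * (M₂ * ∑ i, ‖b i‖) * Real.exp (ρ₂ * d₀)) * ((Fintype.card ι * M₂ * ∑ i, ‖b i‖) * (4 * Real.exp ((ρ + γ) * d₀))) * α₁ ^ 2
                    * (Λv * (Λ * B6.c1 d δ₀ β) ^ 2)))
          * α₁ * (g.len a ^ 2)⁻¹ * Real.exp (-(ρ * g.dist a a'))) := by
  classical
  -- abbreviations
  set c : ℂ := ((g.eta : ℂ)⁻¹) with hc
  set Mb : ℝ := M₂ * ∑ i, ‖b i‖ with hMb
  set cE₃ : ℝ := 4 * Mb * Real.exp (ρ₃ * d₀) with hcE₃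
  set cE₂ : ℝ := 4 * Mb * Real.exp (ρ₂ * d₀) with hcE₂
  set cEs : ℝ := (Fintype.card ι * M₂ * ∑ i, ‖b i‖) * (4 * Real.exp ((ρ + γ) * d₀)) with hcEs
  set Dμ : κ → Module.End ℝ (S × ι → ℝ) := fun μ => conj b (diffLetter T U c (Sum.inl μ)) with hDμ
  set Δμ : κ → Module.End ℝ (S × ι → ℝ) := fun μ => conj b (diffLetter T (prodCfg U g.eta A) c (Sum.inl μ)) - conj b (diffLetter T U c (Sum.inl μ))
    with hΔμ
  set Dsν : κ → Module.End ℝ (S × ι → ℝ) := fun ν => conj b (diffLetter T U c (Sum.inr ν)) with hDsν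
  set Δsν : κ → Module.End ℝ (S × ι → ℝ) := fun ν => conj b (diffLetter T (prodCfg U g.eta A) c (Sum.inr ν)) - conj b (diffLetter T U c (Sum.inr ν))
    with hΔsν
  have hbsum : 0 ≤ ∑ i, ‖b i‖ := Finset.sum_nonneg fun i _ => norm_nonneg _
  have hMb0 : 0 ≤ Mb := by rw [hMb]; positivity
  have hcE₃0 : 0 ≤ cE₃ := by rw [hcE₃]; positivity
  have hcE₂0 : 0 ≤ cE₂ := by rw [hcE₂]; positivity
  have hcEs0 : 0 ≤ cEs := by rw [hcEs]; positivity
  have hcc : 0 ≤ B6.c1 d δ₀ β := B6RandomWalk.c1_nonneg d δ₀ β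
  have hΛ0 : 0 ≤ Λ := zero_le_one.trans hΛ
  have hs : 0 ≤ (α + β) * δ₀ := by positivity
  have hρ₁ : 0 ≤ ρ₁ := by linarith
  have hρ₂ : 0 ≤ ρ₂ := by linarith
  have hρ₃ : 0 ≤ ρ₃ := by linarith
  have hργ : 0 ≤ ρ + γ := add_nonneg hρ hγ
  have hw1 : ∀ a : g.Site, 0 ≤ g.len a := fun a => (hlen a).le
  have hw2 : ∀ a : g.Site, 0 ≤ g.len a ^ 2 := fun a => sq_nonneg _
  have hw1i : ∀ a : g.Site, 0 ≤ (g.len a)⁻¹ := fun a => inv_nonneg.mpr (hlen a).le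
  have hw2i : ∀ a : g.Site, 0 ≤ (g.len a ^ 2)⁻¹ := fun a => inv_nonneg.mpr (sq_nonneg _)
  have hw4i : ∀ a : g.Site, 0 ≤ (g.len a ^ 4)⁻¹ := fun a => inv_nonneg.mpr (pow_nonneg (hlen a).le 4)
  have hKα : 0 ≤ KP * α₁ := mul_nonneg hKP hα₁
  -- the inputs at the rates the devices want
  have hGp₂ := hasMajorant_rate_mono (R := Rr) (H := H) (fun p : S × ι => blk p.1) BG (fun a => g.len a ^ 2) hBG hw2 (by linarith : ρ₂ ≤ δG) hdnn h342_1
  have hGp₃ := hasMajorant_rate_mono (R := Rr) (H := H) (fun p : S × ι => blk p.1) BG (fun a => g.len a ^ 2) hBG hw2 hδG hdnn h342_1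
  have hDGp₂ : ∀ μ, HasMajorant (g := toB6 g Rr H) (fun p : S × ι => blk p.1) (Dμ μ * Gp) (fun a a' => BG * g.len a * Real.exp (-(ρ₂ * g.dist a a'))) :=
    fun μ => hasMajorant_rate_mono (R := Rr) (H := H) (fun p : S × ι => blk p.1) BG (fun a => g.len a) hBG hw1 (by linarith : ρ₂ ≤ δG) hdnn (h342_2 μ)
  have hMid₁ := hasMajorant_rate_mono (R := Rr) (H := H) (fun p : S × ι => blk p.1) κM (fun a => (g.len a ^ 4)⁻¹) hκM hw4i hδM hdnn hMid
  have hGpk₁ := hasKernelBound_rate_mono (R := Rr) (H := H) (fun p : S × ι => blk p.1) hv cK BG (fun a => g.len a ^ 2) hBG hw2 (by linarith : ρ₁ ≤ δG)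
    hdnn hGpk
  have hGpDk₁ : ∀ ν, HasKernelBound (g := toB6 g Rr H) (fun p : S × ι => blk p.1) v cK (Gp * Dsν ν)
      (fun a a' => BG * g.len a * Real.exp (-(ρ₁ * g.dist a a'))) :=
    fun ν => hasKernelBound_rate_mono (R := Rr) (H := H) (fun p : S × ι => blk p.1) hv cK BG (fun a => g.len a) hBG hw1 (by linarith : ρ₁ ≤ δG)
      hdnn (hGpDk ν)
  have hPp₁ : HasKernelBound (g := toB6 g Rr H) (fun p : S × ι => blk p.1) v cK Pp (fun a a' => KP * α₁ * Real.exp (-(ρ₁ * g.dist a a'))) :=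
    hasKernelBound_mono (g := toB6 g Rr H) _ hv hPp fun a a' => mul_le_mul_of_nonneg_left (exp_rate_mono hδP (hdnn a a')) hKα
  have hDPp₁ : ∀ μ, HasKernelBound (g := toB6 g Rr H) (fun p : S × ι => blk p.1) v cK (Dμ μ * Pp)
      (fun a a' => KP * α₁ * (g.len a)⁻¹ * Real.exp (-(ρ₁ * g.dist a a'))) :=
    fun μ => hasKernelBound_rate_mono (R := Rr) (H := H) (fun p : S × ι => blk p.1) hv cK (KP * α₁) (fun a => (g.len a)⁻¹) hKα hw1i hδP hdnn (hDPp μ)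
  have hPpDs₁ : ∀ ν, HasKernelBound (g := toB6 g Rr H) (fun p : S × ι => blk p.1) v cK (Pp * Dsν ν)
      (fun a a' => KP * α₁ * (g.len a)⁻¹ * Real.exp (-(ρ₁ * g.dist a a'))) :=
    fun ν => hasKernelBound_rate_mono (R := Rr) (H := H) (fun p : S × ι => blk p.1) hv cK (KP * α₁) (fun a => (g.len a)⁻¹) hKα hw1i hδP hdnn (hPpDs ν)
  have hDPpDs₁ : ∀ μ ν, HasKernelBound (g := toB6 g Rr H) (fun p : S × ι => blk p.1) v cK (Dμ μ * Pp * Dsν ν)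
      (fun a a' => KP * α₁ * (g.len a ^ 2)⁻¹ * Real.exp (-(ρ₁ * g.dist a a'))) :=
    fun μ ν => hasKernelBound_rate_mono (R := Rr) (H := H) (fun p : S × ι => blk p.1) hv cK (KP * α₁) (fun a => (g.len a ^ 2)⁻¹) hKα hw2i hδP hdnn
      (hDPpDs μ ν)
  -- §2: the difference letters (majorant of `Δ_μ` at the rates `ρ₃`, `ρ₂`; column of `Δ*_ν` at `ρ + γ`)
  have hΔ₃ : ∀ μ, HasMajorant (g := toB6 g Rr H) (fun p : S × ι => blk p.1) (Δμ μ)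
      (fun a a' => cE₃ * α₁ * (g.len a)⁻¹ * Real.exp (-(ρ₃ * g.dist a a'))) := fun μ => by
    have h := hasMajorant_diffLetter_sub_inl (Rr := Rr) (H := H) b T U blk hη hU1 A d₀ ρ₃ M₂ α₁ hα₁ hρ₃ hM₂ hrepr hlen hA hsmall hd₀F μ
    exact hasMajorant_mono (g := toB6 g Rr H) _ h fun a a' => le_of_eq (by rw [hcE₃, hMb])
  have hΔ₂ : ∀ μ, HasMajorant (g := toB6 g Rr H) (fun p : S × ι => blk p.1) (Δμ μ)
      (fun a a' => cE₂ * α₁ * (g.len a)⁻¹ * Real.exp (-(ρ₂ * g.dist a a'))) := fun μ => by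
    have h := hasMajorant_diffLetter_sub_inl (Rr := Rr) (H := H) b T U blk hη hU1 A d₀ ρ₂ M₂ α₁ hα₁ hρ₂ hM₂ hrepr hlen hA hsmall hd₀F μ
    exact hasMajorant_mono (g := toB6 g Rr H) _ h fun a a' => le_of_eq (by rw [hcE₂, hMb])
  have hΔs : ∀ ν, ∀ (x' : S × ι) (y'' : g.Site), (∑ z ∈ Finset.univ.filter (fun z : S × ι => blk z.1 = y''), |Δsν ν (Pi.single x' 1) z|) ≤
      cEs * α₁ * (g.len y'')⁻¹ * Real.exp (-((ρ + γ) * g.dist y'' (blk x'.1))) := fun ν x' y'' => by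
    have h := col_diffLetter_sub_inr b T U blk hη hU1 A d₀ (ρ + γ) M₂ α₁ hα₁ hργ hM₂ hrepr hlen hAτB hsmall hd₀B ν x' y''
    rw [conj_sub] at h
    refine h.trans (le_of_eq ?_)
    rw [hcEs]; ring
  -- §3: the site words
  -- W₁ ↦ `Δ_μ·R·D*_ν`
  have hS1 : ∀ μ ν, HasKernelBound (g := toB6 g Rr H) (fun p : S × ι => blk p.1) v cK (Δμ μ * R * Dsν ν)
      (fun a a' => (cE₃ * BG * κM * BG * (Λ * B6.c1 d δ₀ β) ^ 3) * α₁ * (g.len a ^ 2)⁻¹ * Real.exp (-(ρ * g.dist a a'))) := fun μ ν => by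
    rw [hR]
    exact hasKernelBound_word_one (Rr := Rr) (H := H) (fun p : S × ι => blk p.1) d δ₀ α β ρ ρ₁ ρ₃ Λ cE₃ BG κM BG α₁ hcE₃0 hBG hκM hBG hα₁ hΛ0
      hρ hρ₁ hs hr (by linarith) hdnn htri hlen h261 hT1 hT2i hT4i hv hcK (hΔ₃ μ) hGp₃ hMid₁ (hGpDk₁ ν)
  -- W₂ ↦ `D_μ·R·Δ*_ν`
  have hS2 : ∀ μ ν, HasKernelBound (g := toB6 g Rr H) (fun p : S × ι => blk p.1) v cK (Dμ μ * R * Δsν ν)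
      (fun a a' => (BG * κM * BG * cEs * Λv * (Λ * B6.c1 d δ₀ β) ^ 3) * α₁ * (g.len a ^ 2)⁻¹ * Real.exp (-(ρ * g.dist a a'))) := fun μ ν => by
    have h := hasKernelBound_word_two (Rr := Rr) (H := H) (fun p : S × ι => blk p.1) d δ₀ α β γ ρ ρ₁ ρ₂ Λ Λv BG κM BG cEs α₁ hBG hκM hBG hcEs0
      hα₁ hΛ0 hΛv hρ hρ₁ hr hr₁ hdnn htri hlen h261 hT1 hT1i hT4i hv hcK hTv (hDGp₂ μ) hMid₁ hGpk₁ (hΔs ν)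
    have e : Dμ μ * R * Δsν ν = Dμ μ * Gp * Mid * (Gp * Δsν ν) := by rw [hR]; noncomm_ring
    rw [e]; exact h
  -- W₃ ↦ `Δ_μ·R·Δ*_ν` (left letter `Δ_μ·G′ ≺ c_Eα₁B_GΛc₁·Lʲη·e^{−ρ₂d}`)
  have hΔGp : ∀ μ, HasMajorant (g := toB6 g Rr H) (fun p : S × ι => blk p.1) (Δμ μ * Gp)
      (fun a a' => (cE₃ * α₁ * BG * (Λ * B6.c1 d δ₀ β)) * g.len a * Real.exp (-(ρ₂ * g.dist a a'))) := fun μ => by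
    have h := hasMajorant_comp_decay (R := Rr) (H := H) (fun p : S × ι => blk p.1) d δ₀ α β ρ₂ ρ₃ Λ (cE₃ * α₁) BG (fun a => (g.len a)⁻¹)
      (fun a => g.len a ^ 2) hw1i hw2 hΛ0 (mul_nonneg hcE₃0 hα₁) hBG hρ₂ hr₂ hdnn htri hT2 h261 (hΔ₃ μ) hGp₂
    refine hasMajorant_mono (g := toB6 g Rr H) _ h fun a a' => le_of_eq ?_
    have hℓ : g.len a ≠ 0 := (hlen a).ne'
    field_simp
  have hS3 : ∀ μ ν, HasKernelBound (g := toB6 g Rr H) (fun p : S × ι => blk p.1) v cK (Δμ μ * R * Δsν ν)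
      (fun a a' => ((cE₃ * α₁ * BG * (Λ * B6.c1 d δ₀ β)) * κM * BG * cEs * Λv * (Λ * B6.c1 d δ₀ β) ^ 3) * α₁ * (g.len a ^ 2)⁻¹ *
        Real.exp (-(ρ * g.dist a a'))) := fun μ ν => by
    have h := hasKernelBound_word_two (Rr := Rr) (H := H) (fun p : S × ι => blk p.1) d δ₀ α β γ ρ ρ₁ ρ₂ Λ Λv (cE₃ * α₁ * BG * (Λ * B6.c1 d δ₀ β))
      κM BG cEs α₁ (by positivity) hκM hBG hcEs0 hα₁ hΛ0 hΛv hρ hρ₁ hr hr₁ hdnn htri hlen h261 hT1 hT1i hT4i hv hcK hTv (hΔGp μ) hMid₁ hGpk₁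
      (hΔs ν)
    have e : Δμ μ * R * Δsν ν = Δμ μ * Gp * Mid * (Gp * Δsν ν) := by rw [hR]; noncomm_ring
    rw [e]; exact h
  -- W₄ ↦ `D′_μ·P′·D*′_ν = (D_μ + Δ_μ)·P′·(D*_ν + Δ*_ν)`
  have hS4 : ∀ μ ν, HasKernelBound (g := toB6 g Rr H) (fun p : S × ι => blk p.1) v cK
      (conj b (diffLetter T (prodCfg U g.eta A) c (Sum.inl μ)) * Pp * conj b (diffLetter T (prodCfg U g.eta A) c (Sum.inr ν)))
      (fun a a' => (KP * (1 + cE₂ * α₁ * (Λ * B6.c1 d δ₀ β) + cEs * α₁ * (Λv * Λ * B6.c1 d δ₀ β)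
          + cE₂ * cEs * α₁ ^ 2 * (Λv * (Λ * B6.c1 d δ₀ β) ^ 2))) * α₁ * (g.len a ^ 2)⁻¹ * Real.exp (-(ρ * g.dist a a'))) := fun μ ν => by
    have h := hasKernelBound_word_pPrime (Rr := Rr) (H := H) (fun p : S × ι => blk p.1) d δ₀ α β γ ρ ρ₁ ρ₂ Λ Λv cE₂ cEs KP α₁ hcE₂0 hcEs0 hKP
      hα₁ hΛ hΛv hρ hα hδ₀ hs hr hr₁ hdnn htri hlen h261 hT1i hv hcK hTv (hΔ₂ μ) (hΔs ν) hPp₁ (hDPp₁ μ) (hPpDs₁ ν) (hDPpDs₁ μ ν)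
    have e1 : Dμ μ + Δμ μ = conj b (diffLetter T (prodCfg U g.eta A) c (Sum.inl μ)) := by simp only [hDμ, hΔμ]; abel
    have e2 : Dsν ν + Δsν ν = conj b (diffLetter T (prodCfg U g.eta A) c (Sum.inr ν)) := by simp only [hDsν, hΔsν]; abel
    rw [e1, e2] at h
    exact h
  -- §1: the dictionary, word by word
  have hX_D : ∀ (m : S × ι → ℝ) (q : (κ × S) × ι), conjHom b (gradLin T c U) m q = Dμ q.1.1 m (q.1.2, q.2) :=
    fun m q => conjHom_gradLin_apply b T U c m q
  have hX_D' : ∀ (m : S × ι → ℝ) (q : (κ × S) × ι), conjHom b (gradLin T c (prodCfg U g.eta A)) m q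
      = conj b (diffLetter T (prodCfg U g.eta A) c (Sum.inl q.1.1)) m (q.1.2, q.2) :=
    fun m q => conjHom_gradLin_apply b T (prodCfg U g.eta A) c m q
  have hX_Δ : ∀ (m : S × ι → ℝ) (q : (κ × S) × ι), (conjHom b (gradLin T c (prodCfg U g.eta A)) - conjHom b (gradLin T c U)) m q
      = Δμ q.1.1 m (q.1.2, q.2) := fun m q => gradType_sub b T c U (prodCfg U g.eta A) m q
  have hY_Ds : ∀ F : (κ × S) × ι → ℝ, conjHom b (divLin T c U) F = -∑ ν, Dsν ν (dirRestr ν F) :=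
    fun F => conjHom_divLin_eq_sum b T U c F
  have hY_Ds' : ∀ F : (κ × S) × ι → ℝ, conjHom b (divLin T c (prodCfg U g.eta A)) F
      = -∑ ν, conj b (diffLetter T (prodCfg U g.eta A) c (Sum.inr ν)) (dirRestr ν F) :=
    fun F => conjHom_divLin_eq_sum b T (prodCfg U g.eta A) c F
  have hY_Δs : ∀ F : (κ × S) × ι → ℝ, (conjHom b (divLin T c (prodCfg U g.eta A)) - conjHom b (divLin T c U)) F = -∑ ν, Δsν ν (dirRestr ν F) :=
    fun F => divType_sub b T c U (prodCfg U g.eta A) F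
  have hW1 := hasKernelBound_dressed (Rr := Rr) (H := H) blk hX_Δ hY_Ds R (fun μ ν => hS1 μ ν)
  have hW2 := hasKernelBound_dressed (Rr := Rr) (H := H) blk hX_D hY_Δs R (fun μ ν => hS2 μ ν)
  have hW3 := hasKernelBound_dressed (Rr := Rr) (H := H) blk hX_Δ hY_Δs R (fun μ ν => hS3 μ ν)
  have hW4 := hasKernelBound_dressed (Rr := Rr) (H := H) blk hX_D' hY_Ds' Pp (fun μ ν => hS4 μ ν)
  have hall := hasKernelBound_add (g := toB6 g Rr H) _ (hasKernelBound_add (g := toB6 g Rr H) _ (hasKernelBound_add (g := toB6 g Rr H) _ hW1 hW2) hW3) hW4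
  refine hasKernelBound_mono (g := toB6 g Rr H) _ hv hall fun a a' => le_of_eq ?_
  rw [hcE₃, hcE₂, hcEs, hMb]
  ring

end POne

end Literature.MathematicalPhysics.QuantumFieldTheory.Balaban1983to89.B9Ineq377POneRightKernel
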